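import Mathlib
import Summits.ResolutionOfSingularities.ResolutionOfSingularities.Theorems.WeightedInvariantLocalWeightedDropWildMonicShiftOrderCases
import Summits.ResolutionOfSingularities.ResolutionOfSingularities.Theorems.WeightedInvariantLocalWeightedDropPolyDescentMinimalityForms

/-!
# `WeightedInvariant.LocalWeightedDrop`, line `hasse-ridge-face-selection`, S3ρ flag line, drop side: the FACE TRANSFER through
# `ρ_M = (M+1, M)`-cleanness («cleaning maximises `(ord, ord_x in)`», the heart of Per17 Lemma 9.1.2)

Crux item stmt-ResolutionOfSingularities-8899 `LocalWeightedDrop` (route `ResolutionOfSingularities/WeightedInvariant`), engine of the door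
`HypersurfaceCentreConstruction` stmt-ResolutionOfSingularities-19897.  [OURS · L1 W4.3, chain w43; res-type-013 (hand of Uk-ρD4), filed
stand-alone on res-type-083's word 2026-08-27T09:06:41Z so that both Uk-ρD1 (`AxisPackageN0` item (v), res-D-pv-005 AS stub-7) and Uk-ρD4
cite it.  MAP: S. Perlega, arXiv:2011.14443 Lemma 9.1.2 (p0104: «since `f′` is `ρ`-clean … `ord_(x) minit(J_{2,x₁}) ≤ ord_(x) minit(J_{2,x′})`»,
`ρ(x) = (1,1)`, `ρ(y) = (1,0)`); tools: stub-7's `WildMonic.wMin_shift_le_of_isWClean` (Prop 5.1.3, `…WildMonicShiftOrderCases`) and the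
Newton-set/`wMin` dictionary of `…PolyDescentMinimalityForms`; every object OURS; not a statement of any manuscript.]

Perlega's lexicographic double weight `ρ = (ord, ord_x)` is read through the INTEGER weight `ρ_M = (M+1, M)`:
`ρ_M · P = M·(P₀+P₁) + P₀` (`weight_rho`), so for `M` larger than the face heights the `ρ_M`-minimum of a point set of order `D` is
`M·D + (least P₀ on the D-face)`.
* **`exists_face_point_shift_of_isWClean`** — if the tuple `X` is `ρ_M`-clean (`M > D`) and has a point `P` on its `D`-face, then every
  re-centring `shift d X ψ` whose scaled Newton set keeps all total degrees `≥ D` has a point `Q` on the `D`-line with `Q₀ ≤ P₀`: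
  the `x`-order of the initial form never goes up under a change of the hypersurface.
-/

set_option linter.dupNamespace false -- mandated namespace of this single-conjunct summit

namespace Summit.ResolutionOfSingularities.ResolutionOfSingularities.Theorems

namespace WildMonic

open MvPowerSeries MonicDescent

variable {k : Type} [Field k] {d : ℕ}

/-- The LEXICOGRAPHIC weight `ρ_M = (M+1, M)`: `ρ_M · P = M·(P₀+P₁) + P₀`. [OURS] -/
theorem weight_rho (M : ℕ) (P : Fin 2 →₀ ℕ) :
    Finsupp.weight (fun i : Fin 2 => if i = 0 then M + 1 else M) P = M * (P 0 + P 1) + P 0 := by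
  rw [weight_fin_two, if_pos rfl, if_neg (show (1 : Fin 2) ≠ 0 by decide)]
  ring

/-- **FACE TRANSFER.** `X` a tuple that is `ρ_M`-CLEAN (`ρ_M = (M+1, M)`, `M > D`) with a point `P` of its scaled Newton set ON THE LINE
`P₀ + P₁ = D`; then EVERY re-centring `shift d X ψ` whose scaled Newton set has all total degrees `≥ D` has a point `Q` with `Q₀ + Q₁ = D`
and `Q₀ ≤ P₀` (stub-7's `wMin_shift_le_of_isWClean` for the weight `ρ_M`, decoded by `weight_rho`).
[OURS; cite: Perlega2020, Lemma 9.1.2 + Prop. 5.1.3 (arXiv:2011.14443 chunks p0104, p0056)] -/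
theorem exists_face_point_shift_of_isWClean (p : ℕ) [Fact p.Prime] [CharP k p] (X : Fin d → MvPowerSeries (Fin 2) k)
    (ψ : MvPowerSeries (Fin 2) k) {M D : ℕ} (hMD : D < M)
    (hclean : IsWClean p (fun i : Fin 2 => if i = 0 then M + 1 else M) X)
    {P : Fin 2 →₀ ℕ} (hP : P ∈ newtonSet X) (hPD : P 0 + P 1 = D)
    (hY : ∀ Q ∈ newtonSet (shift d X ψ), D ≤ Q 0 + Q 1) :
    ∃ Q ∈ newtonSet (shift d X ψ), Q 0 + Q 1 = D ∧ Q 0 ≤ P 0 := by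
  set w : Fin 2 → ℕ := fun i : Fin 2 => if i = 0 then M + 1 else M with hw
  have hm : wMin w X ≠ ⊤ := PolyDescent.wMin_ne_top_of_mem_newtonSet w X hP
  have hle : wMin w (shift d X ψ) ≤ wMin w X := wMin_shift_le_of_isWClean w X ψ p hclean hm
  have hPw : wMin w X ≤ ((M * D + P 0 : ℕ) : ℕ∞) := by
    have h := PolyDescent.wMin_le_weight_of_mem_newtonSet w X hP
    rwa [hw, weight_rho, hPD] at h
  have hfin : wMin w (shift d X ψ) ≠ ⊤ := ne_top_of_le_ne_top (ENat.coe_ne_top _) (hle.trans hPw)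
  have hd : 0 < d := pos_of_wMin_ne_top w (shift d X ψ) hfin
  obtain ⟨j, hj⟩ := exists_slotWOrd_eq_wMin w (shift d X ψ) hd
  obtain ⟨Q, hQ, hQw⟩ := PolyDescent.exists_mem_newtonSet_weight_le w (shift d X ψ) hfin j hj.le
  refine ⟨Q, hQ, ?_⟩
  have h1 : ((Finsupp.weight w Q : ℕ) : ℕ∞) ≤ ((M * D + P 0 : ℕ) : ℕ∞) := hQw.trans (hle.trans hPw)
  have h2 : Finsupp.weight w Q ≤ M * D + P 0 := by exact_mod_cast h1
  rw [hw, weight_rho] at h2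
  have h3 := hY Q hQ
  have hPD' : P 0 ≤ D := by omega
  constructor
  · by_contra hne
    have h4 : D + 1 ≤ Q 0 + Q 1 := by omega
    have h5 : M * (D + 1) ≤ M * (Q 0 + Q 1) := Nat.mul_le_mul_left M h4
    rw [Nat.mul_succ] at h5
    omega
  · have h5 : M * D ≤ M * (Q 0 + Q 1) := Nat.mul_le_mul_left M h3
    omega

end WildMonic

end Summit.ResolutionOfSingularities.ResolutionOfSingularities.Theorems
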